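import Literature.Geometry.ComplexHyperbolic.UnitBallIsotropyCharacter
import Literature.NumberTheory.Automorphic.U21KTypes
import HarnessLib

/-!
# The stabiliser of the origin of `𝔹²` in `U(2,1)` IS `U(2) × U(1)`, and its isotropy representation is `𝔭₊` (Jacobowitz 1990, Ch. 2 §1 Lemma 6(2); Borel–Wallach VI 4.7–4.8)

Topic `Geometry/ComplexHyperbolic`; namespace `Literature.Geometry.ComplexHyperbolic.BallModel`.  The tree's
`UnitBallIsotropy` / `UnitBallIsotropyTorusWeights` exhibit `SU(2)` and the diagonal torus inside the stabiliser
`Stab(x₀) ≤ U(2,1)` of the origin `x₀ = 0 ∈ 𝔹²` and compute their Jacobians; `U21KTypes` constructs the abstract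
`K = U(2) × U(1)` (`K21`) with its modules `𝔭₊ : (A,d)·b = d̄ A b`, `𝔭₋ : (A,d)·c = d Ā c`, leaving "the identification
of `K21` with the stabiliser" to the consumer (its module docstring, NOT-here list; likewise `UnitBallIsotropy`:
"the full stabiliser (`= U(2) × U(1)` exactly)").  This file supplies exactly that identification, kernel-checked:

* `bmat A d = diag(A, d) ∈ M₃(ℂ)`; `blockU : K21 →* U21`, `(A, d) ↦ diag(A, d)` (`bmat_conjTranspose_mul_J_mul`);
  `blockU_smul_x₀` (it fixes the origin); `blockK : K21 →* stabilizer U21 x₀`;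
* `mat_col_two_eq_zero_of_smul_x₀` / `mat_row_two_eq_zero_of_smul_x₀`: an element of `U(2,1)` fixing `x₀` is
  block-diagonal; **`stabilizerEquivK21 : K21 ≃* stabilizer U21 x₀`** (`blockK` is bijective) — the stabiliser of
  the origin is EXACTLY `U(2) × U(1)`;
* **`Jac_blockU_x₀ : Jac (diag(A,d)) x₀ = d̄ • A`** — the isotropy representation of `K` on `T_{x₀}𝔹² = ℂ²` is `𝔭₊`
  (`Jac_blockU_x₀_mulVec : Jac (diag(A,d)) x₀ *ᵥ b = pPlus (A,d) b`), and on the inverse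
  `Jac_blockU_inv_x₀_transpose_mulVec : (Jac (diag(A,d))⁻¹ x₀)ᵀ *ᵥ c = pMinus (A,d) c` — the COTANGENT weight
  `k ↦ (Jac k⁻¹ x₀)ᵀ` (the tree's `weightOf x₀` of the cotangent cocycle) is `𝔭₋ = τ`.

## References

* H. Jacobowitz, *An Introduction to CR Structures*, AMS (1990), Ch. 2 §1, Lemma 6(2) p. 41 ("the isotropy subgroup
  of the origin is `{diag(a, M)}`, `a ∈ U(1)`, `M ∈ U(2)`"). [cite: Jacobowitz1990, Ch. 2 §1 Lemma 6(2)]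
* A. Borel, N. Wallach (2000), VI 4.7–4.8 (`K = U(n+1) ∩ G`, `τ₁` on `𝔭₊`). [cite: BorelWallach2000, VI 4.7–4.8]
* R.-P. Holzapfel, *Ball and Surface Arithmetics* (1998), §4.1.

## Provenance

LEAN-IN-TREE rule (2026-08-18), pub-hodgecm model-construction sub-cell, seat mc-theta-2 gen 4: geometric half of the
archimedean `K`-type clause (W-K∞′) (`K₁ := stabilizer U21 x₀`, `τ₁ := weightOf x₀`).
-/

set_option autoImplicit false

noncomputable section

open Matrix MulAction
open scoped ComplexConjugate

namespace Literature.Geometry.ComplexHyperbolic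

namespace BallModel

open Literature.NumberTheory.Automorphic.U21 (K21 matA sclD pPlus pMinus pPlus_apply pMinus_apply matA_mul sclD_mul
  matA_one sclD_one conjTranspose_matA_mul_self matA_mul_conjTranspose_self star_sclD_mul_self sclD_mul_star_self
  sclD_mul_conj_self conj_sclD_mul_self)

/-! ## 1. Block-diagonal matrices `diag(A, d)` -/

/-- `diag(A, d) ∈ M₃(ℂ)` for `A ∈ M₂(ℂ)`, `d ∈ ℂ`. [folklore] -/
def bmat (A : Matrix (Fin 2) (Fin 2) ℂ) (d : ℂ) : Matrix (Fin 3) (Fin 3) ℂ :=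
  !![A 0 0, A 0 1, 0; A 1 0, A 1 1, 0; 0, 0, d]

/-- `diag(A,d) diag(B,e) = diag(AB, de)`. [folklore] -/
theorem bmat_mul (A B : Matrix (Fin 2) (Fin 2) ℂ) (d e : ℂ) : bmat A d * bmat B e = bmat (A * B) (d * e) := by
  ext i j
  fin_cases i <;> fin_cases j <;>
    simp [bmat, Matrix.mul_apply, Fin.sum_univ_three, Fin.sum_univ_two]

/-- `diag(1,1) = 1`. [folklore] -/
@[simp] theorem bmat_one : bmat 1 1 = 1 := by
  ext i j
  fin_cases i <;> fin_cases j <;> simp [bmat]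

/-- `diag(A,d)ᴴ = diag(Aᴴ, d̄)`. [folklore] -/
theorem conjTranspose_bmat (A : Matrix (Fin 2) (Fin 2) ℂ) (d : ℂ) : (bmat A d)ᴴ = bmat Aᴴ (conj d) := by
  ext i j
  fin_cases i <;> fin_cases j <;> simp [bmat, Matrix.conjTranspose_apply]

/-- `J = diag(1, 1, −1) = diag(1₂, −1)`. [folklore] -/
theorem J_eq_bmat : J = bmat 1 (-1) := by
  ext i j
  fin_cases i <;> fin_cases j <;> simp [bmat, J, Matrix.diagonal]

/-- `bmat` is injective in both arguments. [folklore] -/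
theorem bmat_inj {A B : Matrix (Fin 2) (Fin 2) ℂ} {d e : ℂ} (h : bmat A d = bmat B e) : A = B ∧ d = e := by
  refine ⟨?_, by simpa [bmat] using congrFun (congrFun h 2) 2⟩
  ext i j
  fin_cases i <;> fin_cases j
  · simpa [bmat] using congrFun (congrFun h 0) 0
  · simpa [bmat] using congrFun (congrFun h 0) 1
  · simpa [bmat] using congrFun (congrFun h 1) 0
  · simpa [bmat] using congrFun (congrFun h 1) 1

/-- `diag(A, d)` preserves `J` when `Aᴴ A = 1` and `d̄ d = 1`. [folklore] -/
theorem bmat_conjTranspose_mul_J_mul {A : Matrix (Fin 2) (Fin 2) ℂ} {d : ℂ} (hA : Aᴴ * A = 1) (hd : conj d * d = 1) :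
    (bmat A d)ᴴ * J * bmat A d = J := by
  rw [conjTranspose_bmat, J_eq_bmat, bmat_mul, bmat_mul, Matrix.mul_one, hA, mul_neg_one, neg_mul, hd]

/-! ## 2. `U(2) × U(1) →* Stab(x₀) ≤ U(2,1)` -/

/-- **`diag(A, d) ∈ U(2,1)`** for `(A, d) ∈ U(2) × U(1)`. [cite: Jacobowitz1990, Ch. 2 §1 Lemma 6(2)] -/
def blockU : K21 →* U21 where
  toFun k := mkU21 (bmat (matA k) (sclD k))
    (bmat_conjTranspose_mul_J_mul (conjTranspose_matA_mul_self k) (star_sclD_mul_self k))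
  map_one' := by
    apply Subtype.ext; apply Units.ext
    change bmat (matA 1) (sclD 1) = 1
    rw [matA_one, sclD_one, bmat_one]
  map_mul' k k' := by
    apply Subtype.ext; apply Units.ext
    change bmat (matA (k * k')) (sclD (k * k')) = bmat (matA k) (sclD k) * bmat (matA k') (sclD k')
    rw [matA_mul, sclD_mul, bmat_mul]

/-- `mat (blockU (A,d)) = diag(A, d)`. [folklore] -/
@[simp] theorem mat_blockU (k : K21) : mat (blockU k) = bmat (matA k) (sclD k) := rfl

/-- `diag(A,d) · (0,0,1) = (0, 0, d)`. [folklore] -/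
theorem W3_blockU_x₀ (k : K21) (i : Fin 3) : W3 (blockU k) x₀ i = ![0, 0, sclD k] i := by
  rw [W3_apply, mat_blockU]
  fin_cases i <;> simp [bmat, x₀]

/-- **`diag(A, d)` fixes the origin.** [cite: Jacobowitz1990, Ch. 2 §1 Lemma 6(2)] -/
theorem blockU_smul_x₀ (k : K21) : blockU k • x₀ = x₀ := by
  apply Ball.ext; intro i
  rw [smul_val, W3_blockU_x₀, W3_blockU_x₀]
  fin_cases i <;> simp [x₀]

/-- **`U(2) × U(1) →* Stab(x₀)`.** [cite: Jacobowitz1990, Ch. 2 §1 Lemma 6(2)] -/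
def blockK : K21 →* stabilizer U21 x₀ :=
  blockU.codRestrict _ fun k => mem_stabilizer_iff.mpr (blockU_smul_x₀ k)

/-- `(blockK k : U21) = blockU k`. [folklore] -/
@[simp] theorem coe_blockK (k : K21) : ((blockK k : stabilizer U21 x₀) : U21) = blockU k := rfl

/-- `blockU` is injective. [folklore] -/
theorem blockU_injective : Function.Injective blockU := fun k k' h => by
  have h' := bmat_inj (congrArg mat h)
  exact Prod.ext (Subtype.ext h'.1) (Subtype.ext h'.2)

/-- `blockK` is injective. [folklore] -/
theorem blockK_injective : Function.Injective blockK := fun k k' h =>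
  blockU_injective (by simpa using congrArg (fun u : stabilizer U21 x₀ => (u : U21)) h)

/-! ## 3. Every element of the stabiliser is block-diagonal -/

/-- `g · (0,0,1)` is the last column of `g`. [folklore] -/
theorem W3_x₀ (g : U21) (i : Fin 3) : W3 g x₀ i = mat g i 2 := by
  rw [W3_apply]; simp [x₀]

/-- If `g` fixes the origin, the last column of `g` is `(0, 0, g₂₂)`. [cite: Jacobowitz1990, Ch. 2 §1 Lemma 6(2)] -/
theorem mat_col_two_eq_zero_of_smul_x₀ {g : U21} (hg : g • x₀ = x₀) (i : Fin 2) : mat g (Fin.castSucc i) 2 = 0 := by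
  have h := congrArg (fun z : Ball => z.1 i) hg
  simp only [smul_val, W3_x₀] at h
  have h0 : (x₀.1 i : ℂ) = 0 := by simp [x₀]
  rw [h0, div_eq_zero_iff] at h
  exact h.resolve_right (mat_two_two_ne_zero g)

/-- If `g ∈ U(2,1)` fixes the origin, the last row of `g` is `(0, 0, g₂₂)` (from `gᴴ J g = J`). [folklore] -/
theorem mat_row_two_eq_zero_of_smul_x₀ {g : U21} (hg : g • x₀ = x₀) (j : Fin 2) : mat g 2 (Fin.castSucc j) = 0 := by
  have hc0 := mat_col_two_eq_zero_of_smul_x₀ hg 0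
  have hc1 := mat_col_two_eq_zero_of_smul_x₀ hg 1
  simp only [Fin.castSucc_zero, Fin.castSucc_one] at hc0 hc1
  have h := congrFun (congrFun (mat_mem g) (Fin.castSucc j)) 2
  simp only [Matrix.mul_apply, Fin.sum_univ_three, conjTranspose_apply, J, Matrix.diagonal_apply_eq, hc0, hc1,
    mul_zero, zero_add, add_zero] at h
  fin_cases j
  · simp [Matrix.diagonal] at h
    rcases h with h | h
    · simpa using congrArg star h
    · exact absurd h (mat_two_two_ne_zero g)
  · simp [Matrix.diagonal] at h
    rcases h with h | h
    · simpa using congrArg star h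
    · exact absurd h (mat_two_two_ne_zero g)

/-- The upper-left `2 × 2` block of `g ∈ U(2,1)`. [folklore] -/
def ulBlock (g : U21) : Matrix (Fin 2) (Fin 2) ℂ := Matrix.of fun i j => mat g (Fin.castSucc i) (Fin.castSucc j)

/-- An element fixing the origin is `diag(ulBlock g, g₂₂)`. [cite: Jacobowitz1990, Ch. 2 §1 Lemma 6(2)] -/
theorem mat_eq_bmat_of_smul_x₀ {g : U21} (hg : g • x₀ = x₀) : mat g = bmat (ulBlock g) (mat g 2 2) := by
  have hc := mat_col_two_eq_zero_of_smul_x₀ hg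
  have hr := mat_row_two_eq_zero_of_smul_x₀ hg
  have hc0 := hc 0; have hc1 := hc 1; have hr0 := hr 0; have hr1 := hr 1
  simp only [Fin.castSucc_zero, Fin.castSucc_one] at hc0 hc1 hr0 hr1
  ext i j
  fin_cases i <;> fin_cases j <;> simp [bmat, ulBlock, hc0, hc1, hr0, hr1]

/-- For `g` fixing the origin, `(ulBlock g)ᴴ (ulBlock g) = 1` and `conj g₂₂ · g₂₂ = 1`. [folklore] -/
theorem ulBlock_unitary_of_smul_x₀ {g : U21} (hg : g • x₀ = x₀) :
    (ulBlock g)ᴴ * ulBlock g = 1 ∧ conj (mat g 2 2) * mat g 2 2 = 1 := by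
  have h := mat_mem g
  rw [mat_eq_bmat_of_smul_x₀ hg, conjTranspose_bmat, J_eq_bmat, bmat_mul, bmat_mul, Matrix.mul_one, mul_neg_one,
    neg_mul] at h
  obtain ⟨h1, h2⟩ := bmat_inj h
  exact ⟨h1, neg_injective h2⟩

/-- The `U(2) × U(1)`-element of a stabiliser element. [folklore] -/
def toK21 (u : stabilizer U21 x₀) : K21 :=
  (⟨ulBlock (u : U21), Matrix.mem_unitaryGroup_iff'.mpr
      (by simpa only [star_eq_conjTranspose] using (ulBlock_unitary_of_smul_x₀ (mem_stabilizer_iff.mp u.2)).1)⟩,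
    ⟨mat (u : U21) 2 2, Unitary.mem_iff.mpr
      ⟨(ulBlock_unitary_of_smul_x₀ (mem_stabilizer_iff.mp u.2)).2,
        by rw [mul_comm]; exact (ulBlock_unitary_of_smul_x₀ (mem_stabilizer_iff.mp u.2)).2⟩⟩)

/-- `blockK (toK21 u) = u`: **every element of the stabiliser is block-diagonal.**
[cite: Jacobowitz1990, Ch. 2 §1 Lemma 6(2)] -/
theorem blockK_toK21 (u : stabilizer U21 x₀) : blockK (toK21 u) = u := by
  apply Subtype.ext; apply Subtype.ext; apply Units.ext
  change bmat (ulBlock (u : U21)) (mat (u : U21) 2 2) = mat (u : U21)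
  exact (mat_eq_bmat_of_smul_x₀ (mem_stabilizer_iff.mp u.2)).symm

/-- `blockK` is surjective. [folklore] -/
theorem blockK_surjective : Function.Surjective blockK := fun u => ⟨toK21 u, blockK_toK21 u⟩

/-- **`Stab_{U(2,1)}(x₀) = U(2) × U(1)`**: the block embedding is an isomorphism of groups.
[cite: Jacobowitz1990, Ch. 2 §1 Lemma 6(2); BorelWallach2000, VI 4.7] -/
def stabilizerEquivK21 : K21 ≃* stabilizer U21 x₀ :=
  MulEquiv.ofBijective blockK ⟨blockK_injective, blockK_surjective⟩

/-- `stabilizerEquivK21 k = blockK k`. [folklore] -/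
@[simp] theorem stabilizerEquivK21_apply (k : K21) : stabilizerEquivK21 k = blockK k := rfl

/-- `stabilizerEquivK21.symm u = toK21 u`. [folklore] -/
theorem stabilizerEquivK21_symm_apply (u : stabilizer U21 x₀) : stabilizerEquivK21.symm u = toK21 u :=
  stabilizerEquivK21.injective (by rw [MulEquiv.apply_symm_apply, stabilizerEquivK21_apply, blockK_toK21])

/-! ## 4. The isotropy representation: `Jac (diag(A,d)) x₀ = d̄ A` is `𝔭₊`, its inverse-transpose `𝔭₋` -/

/-- **`Jac (diag(A, d)) x₀ = d̄ • A`.** [cite: BorelWallach2000, VI 4.8] -/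
theorem Jac_blockU_x₀ (k : K21) : Jac (blockU k) x₀ = star (sclD k) • matA k := by
  have hd : star (sclD k) * sclD k = 1 := star_sclD_mul_self k
  have hd0 : sclD k ≠ 0 := fun h => by simp [h] at hd
  ext i j
  simp only [Jac, Matrix.of_apply, W3_blockU_x₀, mat_blockU, Matrix.smul_apply, smul_eq_mul]
  fin_cases i <;> fin_cases j <;> simp [bmat] <;> field_simp <;> rw [mul_assoc, sclD_mul_conj_self, mul_one]

/-- `Jac (diag(A,d)) x₀ *ᵥ b = pPlus (A,d) b` — the tangent isotropy representation is `𝔭₊`. [cite: BorelWallach2000, VI 4.8] -/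
theorem Jac_blockU_x₀_mulVec (k : K21) (b : Fin 2 → ℂ) : Jac (blockU k) x₀ *ᵥ b = pPlus k b := by
  rw [Jac_blockU_x₀, Matrix.smul_mulVec, pPlus_apply]

/-- `(Jac (diag(A,d))⁻¹ x₀)ᵀ = d • Ā`. [cite: BorelWallach2000, VI 4.8] -/
theorem Jac_blockU_inv_x₀_transpose (k : K21) : (Jac (blockU k)⁻¹ x₀)ᵀ = sclD k • (matA k)ᴴᵀ := by
  rw [← map_inv, Jac_blockU_x₀, Matrix.transpose_smul]
  congr 1
  · change star (star (sclD k)) = sclD k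
    exact star_star _

/-- `(Jac (diag(A,d))⁻¹ x₀)ᵀ *ᵥ c = pMinus (A,d) c` — the COTANGENT isotropy weight `k ↦ (Jac k⁻¹ x₀)ᵀ` is `𝔭₋ = τ`.
[cite: BorelWallach2000, VI 4.8] -/
theorem Jac_blockU_inv_x₀_transpose_mulVec (k : K21) (c : Fin 2 → ℂ) :
    (Jac (blockU k)⁻¹ x₀)ᵀ *ᵥ c = pMinus k c := by
  rw [Jac_blockU_inv_x₀_transpose, Matrix.smul_mulVec, pMinus_apply]

end BallModel

end Literature.Geometry.ComplexHyperbolic
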